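import Mathlib
import Summits.PneNP.PneNP.Theorems.OverlapGapAlgebraSearchHardWindowLipschitzRungVariance

/-!
# PneNP / OverlapGapAlgebra — crux `SolvableImpliesStableSection` (stmt-PneNP-2463):
# the Lipschitz transfer (1/2) — boost, numerics, growing-loss asymptotics

Support for crux `stmt-PneNP-2463` (`Summit.PneNP.PneNP.Theses.OverlapGapAlgebra.SolvableImpliesStableSection`).
Three self-contained lemmas used by the Lipschitz transfer
(`OverlapGapAlgebraSolvableImpliesStableSectionLipschitzTransfer.lean`: the crux HOLDS for every solver
whose decoded section is `s(n)`-Lipschitz per single-literal change, `s(n)² log³ n = o(n)`):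

* `sissLip_asy_pointwise` — `e^{-t} x^{M(k+1)} + x^M ≤ x^{M(k+1)} e^{-BL}` for `x = e^L`, `L ≥ log 2`,
  `log 2 + BL ≤ t`, `B + 1 ≤ Mk` (the walk-engine asymptotics with a GROWING loss rate `B`);
* `sissLip_km_card_invalid_le` — the validity half of the transfer for a Lipschitz map `g` at fixed
  `(k, m, n)`: success on `≥ ε·#instances` and `8(1 + 10k²s²log²n) ≤ εν²m` give
  `(k m)·#{V_g > ν m} ≤ 4k(1 + 10k²s²log²n)/ν² · #instances` (Efron–Stein variance
  `shwLip_sum_sq_dev_le` with the maximum clause-degree second moment, boost + Chebyshev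
  `shwLip_card_gt_le_of_zeroSet`);
* `sissLip_numerics` — the real-number bookkeeping at a large `n`: `m ≥ 1`, `s ≤ η n`, the boost
  condition, and the two growing-loss conditions `log 2 + 4kA log(2n) ≤ cn`, `4kA + 1 ≤ mk²` for
  `A = 4k(1 + 10k²s²log²n)/ν²`, from `s² log³ n ≤ δ n` with an explicit small `δ`.
No new definitions; axioms `propext`, `Classical.choice`, `Quot.sound`.
-/

set_option linter.dupNamespace false -- `Summit.PneNP.PneNP.…`: summit = sub-problem (D-0017)

namespace Summit.PneNP.PneNP.Theorems

open Finset Filter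
open scoped Classical

/-- Pointwise form of the growing-loss asymptotics: if `x = e^L` with `L ≥ log 2`,
`log 2 + B L ≤ t` and `B + 1 ≤ M k`, then `e^{-t} x^{M(k+1)} + x^M ≤ x^{M(k+1)} e^{-BL}` (each summand
is at most half of the right-hand side). (Same statement as the line-`Sketch` pointwise asymptotics,
where the loss rate `B` is a constant; the transfer uses it with `B = 4k A(n)` growing in `n`.) -/
theorem sissLip_asy_pointwise {x L B t : ℝ} {M k : ℕ} (hxL : Real.exp L = x)
    (hL : Real.log 2 ≤ L) (ht : Real.log 2 + B * L ≤ t) (hMB : B + 1 ≤ ((M * k : ℕ) : ℝ)) :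
    Real.exp (-t) * x ^ (M * (k + 1)) + x ^ M ≤ x ^ (M * (k + 1)) * Real.exp (-(B * L)) := by
  -- adapted from Theorems/OverlapGapAlgebraSolvableImpliesStableSectionAsymptotics.lean (private there)
  have hlog2 : 0 < Real.log 2 := Real.log_pos one_lt_two
  have hLpos : 0 < L := hlog2.trans_le hL
  have hxpos : 0 < x := hxL ▸ Real.exp_pos L
  have hkey : 2 ≤ x ^ (M * k) * Real.exp (-(B * L)) := by
    have h1 : x ^ (M * k) * Real.exp (-(B * L)) = Real.exp (((M * k : ℕ) : ℝ) * L - B * L) := by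
      rw [Real.exp_sub, Real.exp_neg, Real.exp_nat_mul, hxL, div_eq_mul_inv]
    have h2 : (B + 1) * L ≤ ((M * k : ℕ) : ℝ) * L := mul_le_mul_of_nonneg_right hMB hLpos.le
    rw [h1]
    calc (2 : ℝ) = Real.exp (Real.log 2) := (Real.exp_log two_pos).symm
      _ ≤ Real.exp (((M * k : ℕ) : ℝ) * L - B * L) := Real.exp_le_exp.2 (by linarith)
  have hP : x ^ (M * (k + 1)) = x ^ M * x ^ (M * k) := by
    rw [mul_add_one, pow_add, mul_comm]
  have ha : Real.exp (-t) * 2 ≤ Real.exp (-(B * L)) := by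
    calc Real.exp (-t) * 2 = Real.exp (-t + Real.log 2) := by
          rw [Real.exp_add, Real.exp_log two_pos]
      _ ≤ Real.exp (-(B * L)) := Real.exp_le_exp.2 (by linarith)
  have ha' : Real.exp (-t) * x ^ (M * (k + 1)) * 2 ≤ x ^ (M * (k + 1)) * Real.exp (-(B * L)) := by
    calc Real.exp (-t) * x ^ (M * (k + 1)) * 2 = Real.exp (-t) * 2 * x ^ (M * (k + 1)) := by ring
      _ ≤ Real.exp (-(B * L)) * x ^ (M * (k + 1)) :=
        mul_le_mul_of_nonneg_right ha (pow_nonneg hxpos.le _)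
      _ = x ^ (M * (k + 1)) * Real.exp (-(B * L)) := mul_comm _ _
  have hb : x ^ M * 2 ≤ x ^ (M * (k + 1)) * Real.exp (-(B * L)) := by
    rw [hP, mul_assoc]
    exact mul_le_mul_of_nonneg_left hkey (pow_nonneg hxpos.le _)
  linarith

section Boost

variable {m k n : ℕ}

/-- **Validity half of the Lipschitz transfer (fixed `k, m, n`).** Let `g` be `s`-Lipschitz in Hamming
output per single-literal change (`0 ≤ s`), let the maximum clause-degree have second moment
`∑_Φ D(Φ)² ≤ 10 log² n · #instances`, let `g` satisfy at least `ε·#instances` instances, and let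
`8(1 + 10 k² s² log² n) ≤ ε ν² m`. Then the set `G = {Φ : V_g Φ ≤ ν m}` of `νm`-valid instances has
`(k m)·#Gᶜ ≤ 4k(1 + 10k² s² log² n)/ν² · #instances`. (Efron–Stein variance + boost + Chebyshev.) -/
theorem sissLip_km_card_invalid_le (hn : 1 ≤ n) (hm : 1 ≤ m)
    (g : (Fin m → Fin k → Fin n × Bool) → (Fin n → Bool)) (s ν ε : ℝ) (hs : 0 ≤ s)
    (hν : 0 < ν) (hε : 0 < ε)
    (hg : ∀ (Φ : Fin m → Fin k → Fin n × Bool) (a : Fin m) (b : Fin k) (ℓ : Fin n × Bool),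
      (hammingDist (g Φ) (g (Function.update Φ a (Function.update (Φ a) b ℓ))) : ℝ) ≤ s)
    (hD : ∑ Φ : Fin m → Fin k → Fin n × Bool,
        (((univ : Finset (Fin n)).sup fun v =>
          ((univ : Finset (Fin m)).filter fun i => ∃ j, (Φ i j).1 = v).card : ℕ) : ℝ) ^ 2
      ≤ 10 * Real.log n ^ 2 * Fintype.card (Fin m → Fin k → Fin n × Bool))
    (hsucc : ε * Fintype.card (Fin m → Fin k → Fin n × Bool) ≤
      ((Finset.univ.filter fun Φ : Fin m → Fin k → Fin n × Bool =>
        ∀ i, ∃ j, g Φ (Φ i j).1 = (Φ i j).2).card : ℝ))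
    (h8B : 8 * (1 + 10 * k ^ 2 * s ^ 2 * Real.log n ^ 2) ≤ ε * ν ^ 2 * m)
    (G : Finset (Fin m → Fin k → Fin n × Bool))
    (hGdef : G = (univ : Finset (Fin m → Fin k → Fin n × Bool)).filter fun Φ =>
      ((((univ : Finset (Fin m)).filter fun i => ∀ j, g Φ (Φ i j).1 ≠ (Φ i j).2).card : ℕ) : ℝ)
        ≤ ν * m) :
    ((k * m : ℕ) : ℝ) * (Gᶜ.card : ℝ)
      ≤ 4 * k * (1 + 10 * k ^ 2 * s ^ 2 * Real.log n ^ 2) / ν ^ 2 *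
          Fintype.card (Fin m → Fin k → Fin n × Bool) := by
  haveI : Nonempty (Fin n × Bool) := ⟨(⟨0, hn⟩, true)⟩
  have hmR : (1 : ℝ) ≤ m := by exact_mod_cast hm
  have hmpos' : (0 : ℝ) < m := by linarith only [hmR]
  set N : ℝ := (Fintype.card (Fin m → Fin k → Fin n × Bool) : ℝ) with hN
  have hNpos : 0 < N := by rw [hN]; exact_mod_cast Fintype.card_pos
  -- Efron–Stein variance bound
  have hW := shwLip_sum_sq_dev_le hn g s hs hg
  set SumD : ℝ := ∑ Φ : Fin m → Fin k → Fin n × Bool,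
      (((univ : Finset (Fin n)).sup fun v =>
        ((univ : Finset (Fin m)).filter fun i => ∃ j, (Φ i j).1 = v).card : ℕ) : ℝ) ^ 2 with hSumD
  set B : ℝ := 1 + 10 * k ^ 2 * s ^ 2 * Real.log n ^ 2 with hB
  set W : ℝ := m * (N + (k : ℝ) ^ 2 * s ^ 2 * SumD) with hWdef
  have hBpos : 0 < B := by rw [hB]; positivity
  have hWB : W ≤ m * N * B := by
    have h1 : (k : ℝ) ^ 2 * s ^ 2 * SumD ≤ (k : ℝ) ^ 2 * s ^ 2 * (10 * Real.log n ^ 2 * N) :=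
      mul_le_mul_of_nonneg_left hD (by positivity)
    calc W = m * (N + (k : ℝ) ^ 2 * s ^ 2 * SumD) := rfl
      _ ≤ m * (N + (k : ℝ) ^ 2 * s ^ 2 * (10 * Real.log n ^ 2 * N)) := by gcongr
      _ = m * N * B := by rw [hB]; ring
  -- (E1) the boost condition `4 W ≤ (ε/2) N (ν m)²`
  have hE1 : 4 * W ≤ ε / 2 * N * (ν * m) ^ 2 := by
    calc 4 * W ≤ 4 * (m * N * B) := by linarith only [hWB]
      _ = (m * N) * (4 * B) := by ring
      _ ≤ (m * N) * (ε * ν ^ 2 * m / 2) := by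
          apply mul_le_mul_of_nonneg_left _ (by positivity)
          linarith only [h8B]
      _ = ε / 2 * N * (ν * m) ^ 2 := by ring
  -- the zero set of `V_g` contains the solved instances
  have hZ : ∀ Φ ∈ ((univ : Finset (Fin m → Fin k → Fin n × Bool)).filter
      fun Φ => ∀ i, ∃ j, g Φ (Φ i j).1 = (Φ i j).2),
      (fun Ψ : Fin m → Fin k → Fin n × Bool =>
        ((((univ : Finset (Fin m)).filter fun i => ∀ j, g Ψ (Ψ i j).1 ≠ (Ψ i j).2).card : ℕ) : ℝ)) Φ
        = 0 := by
    intro Φ hΦ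
    simp only [mem_filter, mem_univ, true_and] at hΦ
    simp only [Nat.cast_eq_zero, Finset.card_eq_zero, Finset.filter_eq_empty_iff]
    intro i _ hall
    obtain ⟨j, hj⟩ := hΦ i
    exact hall j hj
  have hV0 : ∀ Φ : Fin m → Fin k → Fin n × Bool, 0 ≤ (fun Ψ : Fin m → Fin k → Fin n × Bool =>
      ((((univ : Finset (Fin m)).filter fun i => ∀ j, g Ψ (Ψ i j).1 ≠ (Ψ i j).2).card : ℕ) : ℝ)) Φ :=
    fun Φ => Nat.cast_nonneg _
  have hνm : 0 < ν * m := by positivity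
  have hε2 : 0 < ε / 2 := by positivity
  have hlt' : ε / 2 * (Fintype.card (Fin m → Fin k → Fin n × Bool) : ℝ)
      < (((univ : Finset (Fin m → Fin k → Fin n × Bool)).filter
          fun Φ => ∀ i, ∃ j, g Φ (Φ i j).1 = (Φ i j).2).card : ℝ) := by
    have h2 : 0 < ε / 2 * N := by positivity
    have : ε / 2 * N < ε * N := by linarith only [h2]
    exact this.trans_le hsucc
  have hboost := shwLip_card_gt_le_of_zeroSet
    (fun Ψ : Fin m → Fin k → Fin n × Bool =>
      ((((univ : Finset (Fin m)).filter fun i => ∀ j, g Ψ (Ψ i j).1 ≠ (Ψ i j).2).card : ℕ) : ℝ))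
    hV0 W (ε / 2) (ν * m) hε2 hνm hW _ hZ hlt' hE1
  -- `Gᶜ = {ν m < V_g}`
  have hset : Gᶜ = (univ : Finset (Fin m → Fin k → Fin n × Bool)).filter fun Φ =>
      ν * m < ((((univ : Finset (Fin m)).filter fun i =>
        ∀ j, g Φ (Φ i j).1 ≠ (Φ i j).2).card : ℕ) : ℝ) := by
    rw [hGdef, Finset.compl_filter]
    exact Finset.filter_congr fun Φ _ => by simp only [not_le]
  rw [hset]
  have hm0' : (m : ℝ) ≠ 0 := hmpos'.ne'
  have hν0 : ν ≠ 0 := hν.ne'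
  have hrew : (k : ℝ) * m * (4 * (m * N * B) / (ν * m) ^ 2) = 4 * k * B / ν ^ 2 * N := by
    field_simp
  calc _ ≤ ((k * m : ℕ) : ℝ) * (4 * W / (ν * m) ^ 2) :=
        mul_le_mul_of_nonneg_left hboost (Nat.cast_nonneg _)
    _ ≤ ((k * m : ℕ) : ℝ) * (4 * (m * N * B) / (ν * m) ^ 2) := by
        apply mul_le_mul_of_nonneg_left _ (Nat.cast_nonneg _)
        apply div_le_div_of_nonneg_right _ (by positivity)
        linarith only [hWB]
    _ = 4 * k * B / ν ^ 2 * N := by push_cast; exact hrew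

end Boost

/-- **Numerics of the Lipschitz transfer at a large `n`.** With the explicit small constant `δ`
(`δ ≤ 1`, `δ ≤ εν²α/(160k²)`, `δ ≤ cν²/(1280k⁴)`, `δ ≤ αν²/(1280k³)`), the bound `s² log³ n ≤ δ n` and
four largeness conditions on `n`, at `m ∈ [αn - 1, αn]`: `m ≥ 1`, `s ≤ η n`, the boost condition
`8(1 + 10k²s²log²n) ≤ εν²m`, and the growing-loss conditions `log 2 + 4kA log(2n) ≤ c n` and
`4kA + 1 ≤ m k²` for the loss rate `A = 4k(1 + 10k²s²log²n)/ν²` of the walk engine. -/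
theorem sissLip_numerics (k : ℕ) (hk : 1 ≤ k) (α η ν ε c δ s : ℝ) (hα : 0 < α) (hη : 0 < η)
    (hν : 0 < ν) (hε : 0 < ε) (hc : 0 < c) (hs0 : 0 ≤ s)
    (hδ1 : δ ≤ 1) (hδa : δ ≤ ε * ν ^ 2 * α / (160 * k ^ 2)) (hδc : δ ≤ c * ν ^ 2 / (1280 * k ^ 4))
    (hδb : δ ≤ α * ν ^ 2 / (1280 * k ^ 3)) (n m : ℕ) (hn3 : 3 ≤ n)
    (hC1 : s ^ 2 * Real.log n ^ 3 ≤ δ * n)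
    (hC3 : (8 + ε * ν ^ 2) * 2 / (ε * ν ^ 2 * α) ≤ (n : ℝ))
    (hC4 : (1 + 32 * k ^ 2 / ν ^ 2) * Real.log n ≤ c * n / 2)
    (hC5 : 2 * (16 * k ^ 2 / ν ^ 2 + 1 + k ^ 2) / (k ^ 2 * α) ≤ (n : ℝ))
    (hC6 : 1 / η ^ 2 ≤ (n : ℝ)) (hm_ge : α * n - 1 ≤ m) :
    1 ≤ m ∧ s ≤ η * n ∧
      8 * (1 + 10 * k ^ 2 * s ^ 2 * Real.log n ^ 2) ≤ ε * ν ^ 2 * m ∧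
      Real.log 2 + 4 * k * (4 * k * (1 + 10 * k ^ 2 * s ^ 2 * Real.log n ^ 2) / ν ^ 2) *
          Real.log (2 * n) ≤ c * n ∧
      4 * k * (4 * k * (1 + 10 * k ^ 2 * s ^ 2 * Real.log n ^ 2) / ν ^ 2) + 1
        ≤ ((m * k * k : ℕ) : ℝ) := by
  have hkR : (1 : ℝ) ≤ k := by exact_mod_cast hk
  have hk0 : (0 : ℝ) < k := by linarith
  have hn1 : 1 ≤ n := le_trans (by norm_num) hn3
  have hnR : (1 : ℝ) ≤ n := by exact_mod_cast hn1
  have hn3R : (3 : ℝ) ≤ n := by exact_mod_cast hn3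
  have hnpos : (0 : ℝ) < n := by linarith only [hnR]
  have hlog1 : 1 ≤ Real.log n := by
    rw [← Real.log_exp 1]
    apply Real.log_le_log (Real.exp_pos 1)
    have : Real.exp 1 ≤ 3 := le_of_lt (lt_trans Real.exp_one_lt_d9 (by norm_num))
    exact this.trans hn3R
  have hlog2n : Real.log (2 * n) ≤ 2 * Real.log n := by
    rw [Real.log_mul two_ne_zero hnpos.ne']
    have : Real.log 2 ≤ Real.log n := Real.log_le_log two_pos (by linarith only [hn3R])
    linarith only [this]
  -- `m ≥ 1`
  have hαn2 : 2 ≤ α * n := by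
    have hpos : 0 < ε * ν ^ 2 * α := by positivity
    have h := hC3
    rw [div_le_iff₀ hpos] at h
    have hεν : 0 < ε * ν ^ 2 := by positivity
    have key : ε * ν ^ 2 * 2 ≤ ε * ν ^ 2 * (α * n) := by linarith only [h, hεν]
    exact le_of_mul_le_mul_left key hεν
  have hmR : (1 : ℝ) ≤ m := by linarith only [hm_ge, hαn2]
  have hm1 : 1 ≤ m := by exact_mod_cast hmR
  -- powers of `s`
  have hs'main : s ^ 2 * Real.log n ^ 2 ≤ δ * n := by
    calc s ^ 2 * Real.log n ^ 2 ≤ s ^ 2 * Real.log n ^ 3 := by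
          apply mul_le_mul_of_nonneg_left _ (sq_nonneg _)
          exact pow_le_pow_right₀ hlog1 (by norm_num)
      _ ≤ δ * n := hC1
  have hsη : s ≤ η * n := by
    have h1 : s ^ 2 ≤ n := by
      calc s ^ 2 = s ^ 2 * 1 := by ring
        _ ≤ s ^ 2 * Real.log n ^ 3 := mul_le_mul_of_nonneg_left (one_le_pow₀ hlog1) (sq_nonneg _)
        _ ≤ δ * n := hC1
        _ ≤ 1 * n := mul_le_mul_of_nonneg_right hδ1 hnpos.le
        _ = n := one_mul _
    have h2 : (n : ℝ) ≤ (η * n) ^ 2 := by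
      have hη2 : 0 < η ^ 2 := by positivity
      have : 1 ≤ η ^ 2 * n := by
        rw [div_le_iff₀ hη2] at hC6
        linarith only [hC6]
      calc (n : ℝ) = n * 1 := (mul_one _).symm
        _ ≤ n * (η ^ 2 * n) := mul_le_mul_of_nonneg_left this hnpos.le
        _ = (η * n) ^ 2 := by ring
    exact (pow_le_pow_iff_left₀ hs0 (by positivity) two_ne_zero).1 (h1.trans h2)
  set B : ℝ := 1 + 10 * k ^ 2 * s ^ 2 * Real.log n ^ 2 with hB
  have hBpos : 0 < B := by rw [hB]; positivity
  have hBbound : B ≤ 1 + 10 * k ^ 2 * (δ * n) := by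
    rw [hB]
    have : 10 * (k : ℝ) ^ 2 * (s ^ 2 * Real.log n ^ 2) ≤ 10 * k ^ 2 * (δ * n) :=
      mul_le_mul_of_nonneg_left hs'main (by positivity)
    linarith only [this]
  -- the boost condition
  have h8B : 8 * B ≤ ε * ν ^ 2 * m := by
    have hten : 10 * (k : ℝ) ^ 2 * (δ * n) ≤ ε * ν ^ 2 * α * n / 16 := by
      have hk2 : (0 : ℝ) < 160 * k ^ 2 := by positivity
      have h := hδa
      rw [le_div_iff₀ hk2] at h
      have h' := mul_le_mul_of_nonneg_right h hnpos.le
      linarith only [h']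
    have hC3' : 8 + ε * ν ^ 2 ≤ ε * ν ^ 2 * α * n / 2 := by
      have hpos : 0 < ε * ν ^ 2 * α := by positivity
      have h := hC3
      rw [div_le_iff₀ hpos] at h
      linarith only [h]
    have : ε * ν ^ 2 * (α * n - 1) ≤ ε * ν ^ 2 * m :=
      mul_le_mul_of_nonneg_left hm_ge (by positivity)
    linarith only [hBbound, hten, hC3', this]
  -- the growing-loss conditions
  have ht : Real.log 2 + 4 * k * (4 * k * B / ν ^ 2) * Real.log (2 * n) ≤ c * n := by
    have hν2 : 0 < ν ^ 2 := by positivity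
    have h1 : 4 * k * (4 * k * B / ν ^ 2) * Real.log (2 * n)
        ≤ 32 * k ^ 2 / ν ^ 2 * Real.log n + 320 * k ^ 4 / ν ^ 2 * (s ^ 2 * Real.log n ^ 3) := by
      rw [show 4 * k * (4 * k * B / ν ^ 2) * Real.log (2 * n)
          = (16 * k ^ 2 * (B * Real.log (2 * n))) / ν ^ 2 by ring,
        show 32 * k ^ 2 / ν ^ 2 * Real.log n + 320 * k ^ 4 / ν ^ 2 * (s ^ 2 * Real.log n ^ 3)
          = (16 * k ^ 2 * (2 * Real.log n + 20 * k ^ 2 * (s ^ 2 * Real.log n ^ 3))) / ν ^ 2 by ring]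
      apply div_le_div_of_nonneg_right _ hν2.le
      apply mul_le_mul_of_nonneg_left _ (by positivity)
      calc B * Real.log (2 * n) ≤ B * (2 * Real.log n) := mul_le_mul_of_nonneg_left hlog2n hBpos.le
        _ = 2 * Real.log n + 20 * k ^ 2 * (s ^ 2 * Real.log n ^ 3) := by rw [hB]; ring
    have h2 : 32 * k ^ 2 / ν ^ 2 * Real.log n ≤ c * n / 2 - Real.log 2 := by
      have hlog2 : Real.log 2 ≤ Real.log n := Real.log_le_log two_pos (by linarith only [hn3R])
      have : (1 + 32 * k ^ 2 / ν ^ 2) * Real.log n = Real.log n + 32 * k ^ 2 / ν ^ 2 * Real.log n := by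
        ring
      linarith only [hC4, this, hlog2]
    have h3 : 320 * k ^ 4 / ν ^ 2 * (s ^ 2 * Real.log n ^ 3) ≤ c * n / 4 := by
      have hk4 : (0 : ℝ) < 1280 * k ^ 4 := by positivity
      have h := hδc
      rw [le_div_iff₀ hk4] at h
      calc 320 * k ^ 4 / ν ^ 2 * (s ^ 2 * Real.log n ^ 3) ≤ 320 * k ^ 4 / ν ^ 2 * (δ * n) :=
            mul_le_mul_of_nonneg_left hC1 (by positivity)
        _ = (320 * k ^ 4 * δ) * n / ν ^ 2 := by ring
        _ ≤ (c * ν ^ 2 / 4) * n / ν ^ 2 := by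
            apply div_le_div_of_nonneg_right _ hν2.le
            apply mul_le_mul_of_nonneg_right _ hnpos.le
            linarith only [h]
        _ = c * n / 4 := by field_simp
    have h4 : 0 ≤ c * n / 4 := by positivity
    linarith only [h1, h2, h3, h4]
  have hMB : 4 * k * (4 * k * B / ν ^ 2) + 1 ≤ ((m * k * k : ℕ) : ℝ) := by
    have hν2 : 0 < ν ^ 2 := by positivity
    have h1 : 4 * k * (4 * k * B / ν ^ 2) ≤ 16 * k ^ 2 / ν ^ 2 + 160 * k ^ 4 / ν ^ 2 * (δ * n) := by
      rw [show 4 * k * (4 * k * B / ν ^ 2) = 16 * k ^ 2 * B / ν ^ 2 by ring,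
        show 16 * k ^ 2 / ν ^ 2 + 160 * k ^ 4 / ν ^ 2 * (δ * n)
          = 16 * k ^ 2 * (1 + 10 * k ^ 2 * (δ * n)) / ν ^ 2 by ring]
      apply div_le_div_of_nonneg_right _ hν2.le
      exact mul_le_mul_of_nonneg_left hBbound (by positivity)
    have h2 : 160 * k ^ 4 / ν ^ 2 * (δ * n) ≤ k ^ 2 * (α * n) / 8 := by
      have hk3 : (0 : ℝ) < 1280 * k ^ 3 := by positivity
      have h := hδb
      rw [le_div_iff₀ hk3] at h
      have hk' := mul_le_mul_of_nonneg_left h hk0.le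
      have hkk : (k : ℝ) ≤ k ^ 2 := by rw [sq]; exact le_mul_of_one_le_right hk0.le hkR
      have hαn : 0 ≤ α * n := by positivity
      calc 160 * k ^ 4 / ν ^ 2 * (δ * n) = (160 * k ^ 4 * δ) * n / ν ^ 2 := by ring
        _ ≤ (k * (α * ν ^ 2) / 8) * n / ν ^ 2 := by
            apply div_le_div_of_nonneg_right _ hν2.le
            apply mul_le_mul_of_nonneg_right _ hnpos.le
            linarith only [hk']
        _ = k * (α * n) / 8 := by field_simp
        _ ≤ k ^ 2 * (α * n) / 8 := by
            have := mul_le_mul_of_nonneg_right hkk hαn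
            linarith only [this]
    have h3 : 16 * k ^ 2 / ν ^ 2 + 1 + k ^ 2 ≤ k ^ 2 * (α * n) / 2 := by
      have hpos : (0 : ℝ) < k ^ 2 * α := by positivity
      have h := hC5
      rw [div_le_iff₀ hpos] at h
      linarith only [h]
    have h4 : ((m * k * k : ℕ) : ℝ) ≥ k ^ 2 * (α * n) - k ^ 2 := by
      push_cast
      have := mul_le_mul_of_nonneg_right hm_ge (show (0 : ℝ) ≤ k * k by positivity)
      linarith only [this]
    have h5 : (0 : ℝ) ≤ k ^ 2 * (α * n) := by positivity
    linarith only [h1, h2, h3, h4, h5]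
  exact ⟨hm1, hsη, h8B, ht, hMB⟩

end Summit.PneNP.PneNP.Theorems
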